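import Literature.GroupTheory.CompactGroupHomOpenKernel
import HarnessLib

/-!
# Finite-level factorisation of a twisted action: «`σ ↦ λ_σ` is locally constant»
# (Shimura 1998, §21.4 proof of Thm. 21.4 p. 192 «for the same reason as in the proof of
# Proposition 21.1», §21.1 pp. 189–191 — the ABSTRACT, polarisation-free mechanism)

Topic `Literature/GroupTheory` (Mathlib + `GroupTheory/CompactGroupHomOpenKernel` only; no abelian
varieties).  PROOF-ONLY file (no definition, no named fact; net Literature debt 0).  Cell
`hodgecm-mathlib`, sub-line `a2b-twisted-galois-model` of the `h21` line, stub FL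
(`stub_finiteLevelReciprocity`): the engine behind «there is a finite Galois `k₂ ⊇ k₁k` such that every
`σ ∈ Aut(ℂ/k₂)` acts on the points of finite order `r(w)` by `r(c_σ w)`».

THE SITUATION, abstractly.  A compact topological group `G` (the Galois group) acts on a set `T` (the
points of finite order of `A`); an additive group `M` (Shimura's `K/𝔞`) is mapped injectively into
`T` by `r` (the torsion parametrisation `r = ξ ∘ q`), with OPEN stabilisers `{σ | σ · r(m) = r(m)}`
(every torsion point is rational over a finite extension); a COUNTABLE group `D` (the units `𝓞_K^×`,
through `ι`) acts faithfully on `M`, and `M` is exhausted by finite «levels» `S i` (the `n`-torsion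
`n⁻¹𝔞/𝔞`); finally `σ ↦ c_σ` is a multiplicative family of maps `M → M` commuting with `D` and with
open «stabilisers» `{σ | c_σ m = m}` (Shimura's `c_σ = β(y)f(y)⁻¹` acting on `K/𝔞`, `c_σ𝔞 = 𝔞`; class
field theory makes it continuous and multiplicative).  HYPOTHESIS: for every `σ` SOME unit `u`
satisfies `σ · r(m) = r(u · c_σ m)` for all `m` — this is what the main theorem of complex
multiplication gives after the isomorphism `λ_σ : A → A^σ` has been compared with the canonical one
for `σ` fixing the field of definition (`λ_σ = can_σ ∘ ι(u_σ)`).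

CONCLUSIONS.
* `exists_monoidHom_forall_smul_eq` — the unit is UNIQUE and `σ ↦ u_σ` is a HOMOMORPHISM
  `h : G →* D` (uniqueness: `D` acts faithfully and `c_σ` is onto; multiplicativity: compare
  `(στ) · r(m)` computed in two ways, `r` injective) — Shimura's «`c` is uniquely determined by `σ` …
  `λ_{στ} = λ_σ^τ λ_τ`» in the units;
* `exists_monoidHom_isOpen_ker_forall_smul_eq` — **its kernel is OPEN**: the reduction of `h`
  modulo each level (`h σ` fixes `S i` pointwise) is continuous, being read off the action of `σ` on
  the finitely many points `r(m)`, `m ∈ S i`, and on `c_σ|_{S i}`; the levels separate `D`; `D` is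
  countable; so the open-kernel principle (`isOpen_ker_of_isOpen_comap_of_countable_codomain`: a
  closed subgroup of countable index in a compact group is open, Baire) applies — NO finiteness of an
  automorphism group, no polarisation;
* `exists_isOpen_subgroup_forall_smul_eq` — hence an OPEN subgroup `U ≤ G` (↔ a finite Galois level
  `k₂`) on which `σ · r(m) = r(c_σ m)` for all `m`: the finite-level reciprocity law.

## References

* [Shimura1998] G. Shimura, *Abelian Varieties with Complex Multiplication and Modular Functions*
  (1998), §21.4 proof of Thm. 21.4 (p. 192), §21.1 proof of Prop. 21.1 (pp. 189–191).
* [Gao2009InvariantDST] Su Gao, *Invariant Descriptive Set Theory* (2009), §2.3 Thm. 2.3.2, §2.2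
  Exercise 2.2.6 (Baire: closed subgroups of countable index are open).
-/

namespace Literature.GroupTheory

open scoped _root_.Topology
open _root_.Set

/-! ### Algebra: the twisting units are unique and multiplicative -/

section Algebra

variable {G : Type*} [Group G] {T : Type*} [MulAction G T] {M : Type*} {D : Type*} [Group D]
  [MulAction D M]

/-- Faithful actions: if `u · φ(m) = u′ · φ(m)` for all `m` and `φ` is onto, then `u = u′`. [folklore] -/
private theorem eq_of_forall_smul_apply_eq (hfaith : ∀ u : D, (∀ m : M, u • m = m) → u = 1)
    {φ : M → M} (hφ : Function.Surjective φ) {u u' : D} (h : ∀ m, u • φ m = u' • φ m) :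
    u = u' := by
  have h1 : u'⁻¹ * u = 1 := hfaith _ fun x => by
    obtain ⟨m, rfl⟩ := hφ x
    rw [mul_smul, h m, inv_smul_smul]
  exact (inv_mul_eq_one.mp h1).symm

/-- A multiplicative family `c : G → (M → M)` with `c 1 = id` consists of surjections
(`c σ ∘ c σ⁻¹ = id`). [folklore] -/
private theorem surjective_of_mul_family {c : G → M → M} (hc_one : ∀ m, c 1 m = m)
    (hc_mul : ∀ σ τ m, c (σ * τ) m = c σ (c τ m)) (σ : G) : Function.Surjective (c σ) :=
  fun x => ⟨c σ⁻¹ x, by rw [← hc_mul, mul_inv_cancel, hc_one]⟩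

/-- **The twisting units form a homomorphism** (Shimura p. 192: «`c` is uniquely determined by `σ`»,
«`λ_{στ} = λ_σ^τ λ_τ`», read in the group of units).  Let `G` act on `T`, let `r : M → T` be injective,
let the group `D` act faithfully on `M`, and let `c : G → (M → M)` be multiplicative with `c 1 = id`
and commute with `D`.  If for every `σ` some `u ∈ D` satisfies `σ · r(m) = r(u · c_σ m)` for all `m`,
then these `u` are the values of a (unique) HOMOMORPHISM `h : G →* D` with
`σ · r(m) = r(h(σ) · c_σ m)`. [cite: Shimura1998, §21.4 proof of Thm. 21.4 p. 192 («c is uniquely determined by σ», «λ_{στ} = λ_σ^τ λ_τ»)] -/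
theorem exists_monoidHom_forall_smul_eq (r : M → T) (c : G → M → M) (hr : Function.Injective r)
    (hfaith : ∀ u : D, (∀ m : M, u • m = m) → u = 1) (hc_one : ∀ m, c 1 m = m)
    (hc_mul : ∀ σ τ m, c (σ * τ) m = c σ (c τ m))
    (hcomm : ∀ (u : D) (σ : G) (m : M), c σ (u • m) = u • c σ m)
    (H : ∀ σ : G, ∃ u : D, ∀ m, σ • r m = r (u • c σ m)) :
    ∃ h : G →* D, ∀ σ m, σ • r m = r (h σ • c σ m) := by
  choose u hu using H
  -- uniqueness of the unit at each `σ`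
  have huniq : ∀ (σ : G) (u' : D), (∀ m, σ • r m = r (u' • c σ m)) → u' = u σ :=
    fun σ u' hu' => eq_of_forall_smul_apply_eq hfaith (surjective_of_mul_family hc_one hc_mul σ)
      fun m => hr (by rw [← hu' m, hu σ m])
  refine ⟨MonoidHom.mk' u fun σ τ => ?_, hu⟩
  -- multiplicativity: compute `(στ) · r(m)` twice
  symm
  refine huniq (σ * τ) (u σ * u τ) fun m => ?_
  rw [mul_smul σ τ (r m), hu τ m, hu σ, hcomm, hc_mul, mul_smul (u σ)]

end Algebra

/-! ### Topology: the kernel is open — the finite level -/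

section Topology

variable {G : Type*} [Group G] [TopologicalSpace G] [IsTopologicalGroup G] [CompactSpace G]
  {T : Type*} [MulAction G T] {M : Type*} {D : Type*} [Group D] [Countable D] [MulAction D M]
  {ι : Sort*}

/-- **Open kernel of the twisting homomorphism.**  In the situation of
`exists_monoidHom_forall_smul_eq`, assume moreover: `G` is a COMPACT topological group, the
stabilisers `{σ | σ · r(m) = r(m)}` and `{σ | c_σ m = m}` are open for every `m`, `D` is countable,
and `M` is exhausted by finite levels `S i` (`⋃ S i = M`, each `S i` finite).  Then the twisting
homomorphism `h : G →* D` (`σ · r(m) = r(h(σ) · c_σ m)`) has OPEN KERNEL: its reduction modulo each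
level is continuous (read off finitely many open stabilisers), the levels separate the faithfully
acting `D`, and a closed subgroup of countable index in a compact group is open (Baire; the tree's
`isOpen_ker_of_isOpen_comap_of_countable_codomain`).  This is Shimura's «for the same reason as in
the proof of Proposition 21.1 … `λ_σ` depends only on the restriction of `σ` to a finite extension»
WITHOUT the finiteness of the automorphism group of a polarised structure.
[cite: Shimura1998, §21.4 proof of Thm. 21.4 p. 192 with §21.1 proof of Prop. 21.1 pp. 189–191] [cite: Gao2009InvariantDST, §2.3 Thm 2.3.2 (Pettis) and §2.2 Exercise 2.2.6] -/
theorem exists_monoidHom_isOpen_ker_forall_smul_eq (r : M → T) (c : G → M → M)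
    (S : ι → Set M) (hSfin : ∀ i, (S i).Finite) (hSM : ∀ m, ∃ i, m ∈ S i)
    (hr : Function.Injective r) (hfaith : ∀ u : D, (∀ m : M, u • m = m) → u = 1)
    (hc_one : ∀ m, c 1 m = m) (hc_mul : ∀ σ τ m, c (σ * τ) m = c σ (c τ m))
    (hcomm : ∀ (u : D) (σ : G) (m : M), c σ (u • m) = u • c σ m)
    (hT : ∀ m, IsOpen {σ : G | σ • r m = r m}) (hc : ∀ m, IsOpen {σ : G | c σ m = m})
    (H : ∀ σ : G, ∃ u : D, ∀ m, σ • r m = r (u • c σ m)) :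
    ∃ h : G →* D, IsOpen (h.ker : Set G) ∧ ∀ σ m, σ • r m = r (h σ • c σ m) := by
  obtain ⟨h, hh⟩ := exists_monoidHom_forall_smul_eq r c hr hfaith hc_one hc_mul hcomm H
  refine ⟨h, ?_, hh⟩
  -- the level subgroups of `D`: units fixing `S i` pointwise
  let N : ι → Subgroup D := fun i => ⨅ m ∈ S i, MulAction.stabilizer D m
  have hN : ∀ d : D, (∀ i, d ∈ N i) → d = 1 := fun d hd => hfaith d fun m => by
    obtain ⟨i, hi⟩ := hSM m
    have hdi := hd i
    simp only [N, Subgroup.mem_iInf, MulAction.mem_stabilizer_iff] at hdi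
    exact hdi m hi
  -- the reduction of `h` modulo each level is continuous
  have hopen : ∀ i, IsOpen ((N i).comap h : Set G) := fun i => by
    -- the open neighbourhood of `1` on which `σ` fixes `r(S i)` and `c_σ` fixes `S i`
    let V : Set G := (⋂ m ∈ S i, {σ : G | σ • r m = r m}) ∩ ⋂ m ∈ S i, {σ : G | c σ m = m}
    have hVopen : IsOpen V :=
      ((hSfin i).isOpen_biInter fun m _ => hT m).inter ((hSfin i).isOpen_biInter fun m _ => hc m)
    have h1V : (1 : G) ∈ V := by
      refine ⟨mem_iInter₂.2 fun m _ => ?_, mem_iInter₂.2 fun m _ => ?_⟩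
      · exact one_smul G (r m)
      · exact hc_one m
    have hVN : V ⊆ ((N i).comap h : Set G) := by
      rintro σ ⟨hσr, hσc⟩
      simp only [SetLike.mem_coe, Subgroup.mem_comap, N, Subgroup.mem_iInf,
        MulAction.mem_stabilizer_iff]
      intro m hm
      have h1 : σ • r m = r m := (mem_iInter₂.1 hσr) m hm
      have h2 : c σ m = m := (mem_iInter₂.1 hσc) m hm
      have h3 := hh σ m
      rw [h1, h2] at h3
      exact (hr h3).symm
    exact ((N i).comap h).isOpen_of_mem_nhds (Filter.mem_of_superset (hVopen.mem_nhds h1V) hVN)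
  exact isOpen_ker_of_isOpen_comap_of_countable_codomain h N hN hopen

/-- **Finite-level factorisation.**  Under the hypotheses of
`exists_monoidHom_isOpen_ker_forall_smul_eq` there is an OPEN subgroup `U` of `G` (for a Galois
group: a finite Galois level `k₂`) such that every `σ ∈ U` acts on the points `r(m)` by the UNTWISTED
rule `σ · r(m) = r(c_σ m)` — Shimura's «we can find a finite Galois extension … such that …
`r(w)^σ = r(c_σ w)`» (p. 192 with Prop. 21.1). [cite: Shimura1998, §21.4 proof of Thm. 21.4 p. 192 with §21.1 proof of Prop. 21.1 pp. 189–191] -/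
theorem exists_isOpen_subgroup_forall_smul_eq (r : M → T) (c : G → M → M)
    (S : ι → Set M) (hSfin : ∀ i, (S i).Finite) (hSM : ∀ m, ∃ i, m ∈ S i)
    (hr : Function.Injective r) (hfaith : ∀ u : D, (∀ m : M, u • m = m) → u = 1)
    (hc_one : ∀ m, c 1 m = m) (hc_mul : ∀ σ τ m, c (σ * τ) m = c σ (c τ m))
    (hcomm : ∀ (u : D) (σ : G) (m : M), c σ (u • m) = u • c σ m)
    (hT : ∀ m, IsOpen {σ : G | σ • r m = r m}) (hc : ∀ m, IsOpen {σ : G | c σ m = m})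
    (H : ∀ σ : G, ∃ u : D, ∀ m, σ • r m = r (u • c σ m)) :
    ∃ U : Subgroup G, IsOpen (U : Set G) ∧ ∀ σ ∈ U, ∀ m, σ • r m = r (c σ m) := by
  obtain ⟨h, hker, hh⟩ :=
    exists_monoidHom_isOpen_ker_forall_smul_eq r c S hSfin hSM hr hfaith hc_one hc_mul hcomm hT hc H
  refine ⟨h.ker, hker, fun σ hσ m => ?_⟩
  rw [hh σ m, MonoidHom.mem_ker.1 hσ, one_smul]

end Topology

/-! ### Bundled, levelwise form (the shape delivered by the division fields of `A[N]` and by class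
field theory; `c` and `d` valued in the monoid `AddMonoid.End M = (M →+ M)` — note that Mathlib's
`AddAut M` carries an ADDITIVE group structure, so `G →* AddAut M` is not available) -/

section Levelwise

variable {G : Type*} [Group G] [TopologicalSpace G] [IsTopologicalGroup G] [CompactSpace G]
  {T : Type*} [MulAction G T] {M : Type*} [AddCommGroup M] {D : Type*} [Group D] [Countable D]
  {ι : Sort*}

/-- **Finite-level factorisation, bundled and levelwise.**  Let the compact group `G` act on `T`, let
`r : M → T` be injective on the additive group `M`, let `c : G →* AddMonoid.End M` (Shimura's `c_σ`
acting on `K/𝔞`) and `d : D →* AddMonoid.End M` an INJECTIVE homomorphism (the units `𝓞_K^×` acting on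
`K/𝔞`) with
`d(u)` and `c(σ)` commuting, and let `M` be exhausted by finite levels `S i` such that, LEVELWISE,
`{σ | ∀ m ∈ S i, σ · r(m) = r(m)}` is open (the division field of the level is a finite extension) and
`{σ | ∀ m ∈ S i, c_σ m = m}` is open (class field theory).  If every `σ` admits a `u ∈ D` with
`σ · r(m) = r(d(u)(c_σ m))` for all `m`, then on some OPEN subgroup `U ≤ G`:
`σ · r(m) = r(c_σ m)` for all `σ ∈ U` and all `m` (reduction to `exists_isOpen_subgroup_forall_smul_eq`:
pointwise stabilisers are subgroups containing the open levelwise ones, hence open).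
[cite: Shimura1998, §21.4 proof of Thm. 21.4 p. 192 with §21.1 proof of Prop. 21.1 pp. 189–191] -/
theorem exists_isOpen_subgroup_forall_smul_eq_of_levelwise (r : M → T) (c : G →* AddMonoid.End M)
    (d : D →* AddMonoid.End M) (hd : Function.Injective d) (S : ι → Set M) (hSfin : ∀ i, (S i).Finite)
    (hSM : ∀ m, ∃ i, m ∈ S i) (hr : Function.Injective r)
    (hcomm : ∀ (u : D) (σ : G), Commute (d u) (c σ))
    (hT : ∀ i, IsOpen {σ : G | ∀ m ∈ S i, σ • r m = r m})
    (hc : ∀ i, IsOpen {σ : G | ∀ m ∈ S i, c σ m = m})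
    (H : ∀ σ : G, ∃ u : D, ∀ m, σ • r m = r (d u (c σ m))) :
    ∃ U : Subgroup G, IsOpen (U : Set G) ∧ ∀ σ ∈ U, ∀ m, σ • r m = r (c σ m) := by
  -- `D` acts on `M` through `d` (`u • m = d u m`)
  letI : MulAction D M := MulAction.compHom M d
  -- pointwise stabilisers of the points `r m` are open: subgroups containing an open levelwise one
  have hT' : ∀ m, IsOpen {σ : G | σ • r m = r m} := fun m => by
    obtain ⟨i, hi⟩ := hSM m
    let P : Subgroup G := ⨅ m' ∈ S i, MulAction.stabilizer G (r m')
    have hP : (P : Set G) = {σ : G | ∀ m' ∈ S i, σ • r m' = r m'} := by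
      ext σ
      simp only [P, SetLike.mem_coe, Subgroup.mem_iInf, MulAction.mem_stabilizer_iff,
        Set.mem_setOf_eq]
    have hopen : IsOpen (P : Set G) := hP ▸ hT i
    have hle : P ≤ MulAction.stabilizer G (r m) := fun σ hσ => by
      simp only [P, Subgroup.mem_iInf, MulAction.mem_stabilizer_iff] at hσ ⊢
      exact hσ m hi
    exact Subgroup.isOpen_mono hle hopen
  -- pointwise `c`-stabilisers are open: the same for the action of `G` on `M` through `c`
  have hc' : ∀ m, IsOpen {σ : G | c σ m = m} := fun m => by
    letI : MulAction G M := MulAction.compHom M c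
    have hsmul : ∀ (σ : G) (m' : M), σ • m' = c σ m' := fun _ _ => rfl
    obtain ⟨i, hi⟩ := hSM m
    let P : Subgroup G := ⨅ m' ∈ S i, MulAction.stabilizer G m'
    have hP : (P : Set G) = {σ : G | ∀ m' ∈ S i, c σ m' = m'} := by
      ext σ
      simp only [P, SetLike.mem_coe, Subgroup.mem_iInf, MulAction.mem_stabilizer_iff,
        Set.mem_setOf_eq, hsmul]
    have hopen : IsOpen (P : Set G) := hP ▸ hc i
    have hle : P ≤ MulAction.stabilizer G m := fun σ hσ => by
      simp only [P, Subgroup.mem_iInf, MulAction.mem_stabilizer_iff] at hσ ⊢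
      exact hσ m hi
    have h := Subgroup.isOpen_mono hle hopen
    have hQ : ((MulAction.stabilizer G m : Subgroup G) : Set G) = {σ : G | c σ m = m} := by
      ext σ
      simp only [SetLike.mem_coe, MulAction.mem_stabilizer_iff, Set.mem_setOf_eq, hsmul]
    exact hQ ▸ h
  -- the hypotheses of the pointwise engine
  have hfaith : ∀ u : D, (∀ m : M, u • m = m) → u = 1 := fun u hu =>
    hd (by rw [map_one]; exact AddMonoidHom.ext hu)
  have hc_one : ∀ m, c 1 m = m := fun m => by rw [map_one]; rfl
  have hc_mul : ∀ σ τ m, c (σ * τ) m = c σ (c τ m) := fun σ τ m => by rw [map_mul]; rfl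
  have hcomm' : ∀ (u : D) (σ : G) (m : M), c σ (u • m) = u • c σ m := fun u σ m =>
    (DFunLike.congr_fun (hcomm u σ).eq m).symm
  exact exists_isOpen_subgroup_forall_smul_eq r (fun σ m => c σ m) S hSfin hSM hr hfaith hc_one
    hc_mul hcomm' hT' hc' H

end Levelwise

end Literature.GroupTheory
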